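import Summits.Ventures.PercRepro.RankLevelSetLevelSevenQuart
import Summits.Ventures.PercRepro.S2GiantExactCount
import Summits.Ventures.PercRepro.S1CircuitLadderB

/-!
# PercRepro — THE `e`-FREE CORE AT LEVEL `7` FROM A NUMERIC FORM, ON THE GIANT-EXACT COUNT WITH LEMMA T5 AND THE
`3`- / `4`-CIRCUIT BOUNDS AS PARAMETERS (p8, gen 19; a feeder for S4 — the top of the `q = 7` window, the row `67` and below)

`c025_core_seven_of_form_s34` — `c025_core_seven_of_form_gxt` (RankLevelSetCoreSevenOfFormGXT, p8 g18: p2's core proof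
on the giant-exact count with the numeric form of the cell as a hypothesis and LEMMA T5 for the `5`-circuits) with the
bounds on the `3`-circuits and the `4`-circuits taken as HYPOTHESES `hs3 : s₃ ≤ S3`, `hs4 : s₄ ≤ S4` (`S3 S4 : ℕ`) in place
of LEMMAS T and T4 (`s₃ ≤ d(d+1)/2`, `s₄ ≤ d(d+1)(d+2)/3`), the `N`-side of the form reading
`c₁·(C(n, 7) + σ_m·Π_E″ + 2^{min 79 (7 + d)}) ≤ c₂·2^{d−7}·C(p + 7, 7)` with
`Π_E″ = S3·C(n,5) + S4·C(n,4) + (7d(d+1)(d+2)(d+3)/48)·C(n,3) + s₆·C(n,2) + s₇·n + s₈`; the tail is unchanged. The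
assembly of a row supplies `hs3` from whichever triangle count it uses — at the row `67` the SHARP count
`s₃ ≤ C(d, 2) + 1` (S1TriangleCountSharp: `S1.two_mul_ncard_triangles_le_sharp`), which closes the cells
`(67, 14 … 16)` that LEMMA T leaves open by `0.2 … 0.8 %` — and `hs4` from LEMMA T4 (`S1.three_mul_ncard_four_circuits_le`).
The proof is token for token that of `c025_core_seven_of_form_gxt` with `d(d+1)/2 ↦ S3`, `d(d+1)(d+2)/3 ↦ S4`.
Axioms: standard.
-/

set_option exponentiation.threshold 1024

open scoped Matroid

namespace PercRepro

namespace ThmN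

open Set

variable {α : Type}

/-- **The `e`-free core at level `7` from a numeric form ON THE GIANT-EXACT COUNT WITH LEMMA T5, the `3`- and `4`-circuit
bounds as parameters** (`c025_core_seven_of_form_gxt` with `hs3 : s₃ ≤ S3`, `hs4 : s₄ ≤ S4` as hypotheses): the form
`(c₁, c₂)` of the cell `(p, d)` is the `N`-side `c₁·(C(n, 7) + σ_m·Π_E″ + 2^{min 79 (7+d)}) ≤ c₂·2^{d−7}·C(p+7, 7)` with
`Π_E″ = S3·C(n,5) + S4·C(n,4) + (7d(d+1)(d+2)(d+3)/48)·C(n,3) + C(d+5,6)·C(n,2) + C(d+6,7)·n + C(d+7,8)` and the exact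
`Y`-tail, taken as a HYPOTHESIS; the partition count with the quartic multiplicity, the nullity cap, `f(7) ≤ 79`,
`f(6) ≤ 39`, the giant flat by its powerset (`S2.ncard_eRk_eq_ncard_le_le_giant_exact`) and LEMMA T5
(`S1.fortyEight_mul_ncard_five_circuits_le` with `a = 7`) as in `c025_core_seven_of_form_gxt`. -/
theorem c025_core_seven_of_form_s34 (M : Matroid α) [M.Finite] (p d S3 S4 : ℕ) (hd8 : 8 ≤ d)
    (hR : M.eRank = (p : ℕ∞)) (hn : M.E.ncard = p + d)
    (hfree : ∀ e ∈ M.E, ∃ A ⊆ M.E \ {e}, e ∉ M.closure A ∧ e ∉ M.closure ((M.E \ {e}) \ A))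
    (hs3 : {C | M.IsCircuit C ∧ C.ncard = 3}.ncard ≤ S3)
    (hs4 : {C | M.IsCircuit C ∧ C.ncard = 4}.ncard ≤ S4)
    (hform :
      ∃ c₁ c₂ : ℕ, 0 < c₂ ∧ c₂ < c₁ ∧
      ((c₁ : ℕ) : ℚ) * ((((p + d).choose 7 : ℕ) : ℚ) + (∑ j ∈ Finset.range (d - 7), ((Nat.choose (min 71 (max ((d + min 33 d) / 2 + 1) (min 32 (d - 1) + 2) - 2)) j : ℕ) : ℚ) / (((j + 1) + 3 * (j + 1).choose 2 + 3 * (j + 1).choose 3 + 2 * (j + 1).choose 4 : ℕ) : ℚ)) *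
        (((S3 : ℕ) : ℚ) * ((p + d).choose 5 : ℚ) + ((S4 : ℕ) : ℚ) * ((p + d).choose 4 : ℚ) + ((7 * d * (d + 1) * (d + 2) * (d + 3) / 48 : ℕ) : ℚ) * ((p + d).choose 3 : ℚ) + (((d + 5).choose 6 : ℕ) : ℚ) * ((p + d).choose 2 : ℚ) + (((d + 6).choose 7 : ℕ) : ℚ) * (p + d : ℚ) + (((d + 7).choose 8 : ℕ) : ℚ)) +
        (2 : ℚ) ^ (min 79 (7 + d))) ≤
        ((c₂ : ℕ) : ℚ) * 2 ^ (d - 7) * (((p + 7).choose 7 : ℕ) : ℚ) ∧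
        c₁ * ((p + d).choose 7 * 2 ^ (min 72 d) + (p + d).choose 6 * 2 ^ 33 + (p + d).choose 5 * 2 ^ 14 + (p + d).choose 4 * 2 ^ 6 + (p + d).choose 3 * 2 ^ 3 + (p + d).choose 2 * 2 + (p + d) + 1 + ∑ j ∈ Finset.range (d + 1), (p + d).choose j) ≤ (c₁ - c₂) * 2 ^ (p + d)) :
    RLS M p 7 := by
  classical
  have hEcard : M.ground_finite.toFinset.card = p + d := by
    rw [← Set.ncard_eq_toFinset_card _ M.ground_finite]; exact hn
  -- the core is simple: every circuit has `≥ 3` elements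
  have hL0 : ∀ e ∈ M.E, ¬ M.IsLoop e := not_isLoop_of_free M hfree
  have hs : ∀ e ∈ M.E, ∀ f ∈ M.E, e ≠ f → M.eRk {e, f} = 2 := by
    intro e he f hf hef
    have h2 : (2 : ℕ∞) ≤ M.eRk {e, f} :=
      two_le_eRk_of_two_le_ncard_of_free M hfree (pair_subset he hf) (by rw [ncard_pair hef])
    have h3 : M.eRk {e, f} ≤ 2 := by
      have := M.eRk_le_encard {e, f}
      rwa [encard_pair hef] at this
    exact le_antisymm h3 h2
  have hcirc : ∀ C, M.IsCircuit C → 3 ≤ C.encard := three_le_encard_of_circuit M hL0 hs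
  have hd : M.E.encard = M.eRank + d := by
    rw [hR, ← M.ground_finite.cast_ncard_eq, hn]
    push_cast
    ring
  -- the nullity cap: every `X ⊆ E` has `|X| ≤ r(X) + d`
  have hcap : ∀ X ⊆ M.E, ∀ k : ℕ, M.eRk X ≤ k → X.ncard ≤ k + d := by
    intro X hX k hr
    have h1 := Matroid.encard_le_eRk_add_of_encard_eq hX hd
    have h2 : X.encard ≤ (k : ℕ∞) + d := h1.trans (by gcongr)
    have hfin : X.Finite := M.ground_finite.subset hX
    rw [← hfin.cast_ncard_eq] at h2
    exact_mod_cast h2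
  -- rank-`≤ 7` sets have `≤ min 79 (7 + d)` points, rank-`≤ 6` sets `≤ min 39 (6 + d)`
  have hflat : ∀ X ⊆ M.E, M.eRk X ≤ 7 → X.ncard ≤ min 79 (7 + d) :=
    fun X hX hr => le_min (ncard_le_seventynine_of_eRk_le_seven_of_free M hfree X hX hr) (hcap X hX 7 hr)
  have hflat' : ∀ X ⊆ M.E, M.eRk X ≤ ((7 - 1 : ℕ) : ℕ∞) → X.ncard ≤ min 39 (6 + d) :=
    fun X hX hr => le_min (ncard_le_thirtynine_of_eRk_le_six_of_free M hfree hX (by simpa using hr))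
      (hcap X hX 6 (by simpa using hr))
  have hinter := hinter_seven M hd hfree
  -- the circuit counts: Lemma T, Lemma T4, and the nullity bounds
  have hC1 : ∀ L ⊆ M.E, M.eRk L = 2 → L.ncard ≤ 3 :=
    fun L hL hr => ncard_le_three_of_eRk_two M hs hfree hL hr
  have hC2 : ∀ P ⊆ M.E, M.eRk P ≤ 3 → P.ncard ≤ 6 :=
    fun P hP hr => ncard_le_six_of_eRk_le_three_of_free M hfree hP hr
  have hs5 : {C | M.IsCircuit C ∧ C.ncard = 5}.ncard ≤ 7 * d * (d + 1) * (d + 2) * (d + 3) / 48 := by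
    have h := S1.fortyEight_mul_ncard_five_circuits_le M 7
      (fun X hX hr => by simpa using ncard_le_ten_of_eRk_le_four_of_free M hfree hX hr) hd
    rw [Nat.le_div_iff_mul_le (by norm_num)]
    linarith [h]
  have hs6 : {C | M.IsCircuit C ∧ C.ncard = 6}.ncard ≤ (d + 5).choose 6 :=
    Matroid.ncard_circuits_le_choose_of_encard M hd 5
  have hs7 : {C | M.IsCircuit C ∧ C.ncard = 7}.ncard ≤ (d + 6).choose 7 :=
    Matroid.ncard_circuits_le_choose_of_encard M hd 6
  have hs8 : {C | M.IsCircuit C ∧ C.ncard = 8}.ncard ≤ (d + 7).choose 8 :=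
    Matroid.ncard_circuits_le_choose_of_encard M hd 7
  -- (U): the partition count with the three-multiplicity, in `ℚ`, then the circuit bounds
  have hU0 := S2.ncard_eRk_eq_ncard_le_le_giant_exact M 7 (min 79 (7 + d)) (min 39 (6 + d)) (max ((d + min 33 d) / 2 + 1) (min 32 (d - 1) + 2)) (min 33 d)
    (by norm_num) hcirc hC1 hC2 hflat hflat' hinter hd (by omega) (by omega)
  have hU1 := Matroid.topCount_le_ncard_compl (M := M) hR hd 7
  have hm1 : min (min 79 (7 + d) - (7 + 1)) (max ((d + min 33 d) / 2 + 1) (min 32 (d - 1) + 2) - 2) =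
      min 71 (max ((d + min 33 d) / 2 + 1) (min 32 (d - 1) + 2) - 2) := by omega
  have hm3 : min (min 79 (7 + d)) (7 + d) = min 79 (7 + d) := by omega
  rw [hn, sum_Icc_three_eight_q, hm1, hm3, show d - (7 + 1) + 1 = d - 7 by omega] at hU0
  simp only [show (7 : ℕ) + 1 = 8 from rfl, show (8 : ℕ) - 3 = 5 from rfl, show (8 : ℕ) - 4 = 4 from rfl,
    show (8 : ℕ) - 5 = 3 from rfl, show (8 : ℕ) - 6 = 2 from rfl, show (8 : ℕ) - 7 = 1 from rfl,
    show (8 : ℕ) - 8 = 0 from rfl, Nat.choose_one_right, Nat.choose_zero_right] at hU0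
  have hUq : (Matroid.topCount M p 7 : ℚ) ≤ ((p + d).choose 7 : ℚ) +
      (∑ j ∈ Finset.range (d - 7), ((Nat.choose (min 71 (max ((d + min 33 d) / 2 + 1) (min 32 (d - 1) + 2) - 2)) j : ℕ) : ℚ) / (((j + 1) + 3 * (j + 1).choose 2 + 3 * (j + 1).choose 3 + 2 * (j + 1).choose 4 : ℕ) : ℚ)) *
        (((S3 : ℕ) : ℚ) * ((p + d).choose 5 : ℚ) + ((S4 : ℕ) : ℚ) * ((p + d).choose 4 : ℚ) +
          ((7 * d * (d + 1) * (d + 2) * (d + 3) / 48 : ℕ) : ℚ) * ((p + d).choose 3 : ℚ) + (((d + 5).choose 6 : ℕ) : ℚ) * ((p + d).choose 2 : ℚ) +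
          (((d + 6).choose 7 : ℕ) : ℚ) * (p + d : ℚ) + (((d + 7).choose 8 : ℕ) : ℚ)) +
      (2 : ℚ) ^ (min 79 (7 + d)) := by
    have hU1q : (Matroid.topCount M p 7 : ℚ) ≤
        ({B : Set α | B ⊆ M.E ∧ M.eRk B = 7 ∧ B.ncard ≤ d}.ncard : ℚ) := by exact_mod_cast hU1
    have hsm : {C | M.IsCircuit C ∧ C.ncard = 3}.ncard * (p + d).choose 5 +
        {C | M.IsCircuit C ∧ C.ncard = 4}.ncard * (p + d).choose 4 +
        {C | M.IsCircuit C ∧ C.ncard = 5}.ncard * (p + d).choose 3 +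
        {C | M.IsCircuit C ∧ C.ncard = 6}.ncard * (p + d).choose 2 +
        {C | M.IsCircuit C ∧ C.ncard = 7}.ncard * (p + d) + {C | M.IsCircuit C ∧ C.ncard = 8}.ncard * 1 ≤
        S3 * (p + d).choose 5 + S4 * (p + d).choose 4 +
          7 * d * (d + 1) * (d + 2) * (d + 3) / 48 * (p + d).choose 3 + (d + 5).choose 6 * (p + d).choose 2 +
          (d + 6).choose 7 * (p + d) + (d + 7).choose 8 := by
      have := hs8
      gcongr
      omega
    have hsmq : (({C | M.IsCircuit C ∧ C.ncard = 3}.ncard : ℚ) * ((p + d).choose 5 : ℚ) +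
        ({C | M.IsCircuit C ∧ C.ncard = 4}.ncard : ℚ) * ((p + d).choose 4 : ℚ) +
        ({C | M.IsCircuit C ∧ C.ncard = 5}.ncard : ℚ) * ((p + d).choose 3 : ℚ) +
        ({C | M.IsCircuit C ∧ C.ncard = 6}.ncard : ℚ) * ((p + d).choose 2 : ℚ) +
        ({C | M.IsCircuit C ∧ C.ncard = 7}.ncard : ℚ) * ((p + d : ℕ) : ℚ) +
        ({C | M.IsCircuit C ∧ C.ncard = 8}.ncard : ℚ) * ((1 : ℕ) : ℚ)) ≤
        ((S3 * (p + d).choose 5 + S4 * (p + d).choose 4 +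
          7 * d * (d + 1) * (d + 2) * (d + 3) / 48 * (p + d).choose 3 + (d + 5).choose 6 * (p + d).choose 2 +
          (d + 6).choose 7 * (p + d) + (d + 7).choose 8 : ℕ) : ℚ) := by exact_mod_cast hsm
    have hσm0 : (0 : ℚ) ≤ ∑ j ∈ Finset.range (d - 7), ((Nat.choose (min 71 (max ((d + min 33 d) / 2 + 1) (min 32 (d - 1) + 2) - 2)) j : ℕ) : ℚ) / (((j + 1) + 3 * (j + 1).choose 2 + 3 * (j + 1).choose 3 + 2 * (j + 1).choose 4 : ℕ) : ℚ) :=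
      Finset.sum_nonneg (fun j _ => by positivity)
    refine hU1q.trans (hU0.trans ?_)
    have e1 := mul_le_mul_of_nonneg_left hsmq hσm0
    push_cast at e1 ⊢
    linarith
  -- (Y): the rank-`≤ 7` sets through their closures; the spanning sets by the `5/2` tail
  have hY := Matroid.two_pow_le_midCount_add (M := M) p 7 hR
  have hsum7 := S2.ncard_eRk_le_le_sum M 7
  simp only [Finset.sum_range_succ, Finset.sum_range_zero, zero_add] at hsum7
  have hB := Matroid.ncard_spanning_le (M := M) hd
  rw [hEcard] at hY hB
  obtain ⟨c₁, c₂, hc₂, hc₁₂, hpolyq, hT⟩ := hform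
  have hAB : c₁ * ({X : Set α | X ⊆ M.E ∧ M.eRk X ≤ 7}.ncard +
      {X : Set α | X ⊆ M.E ∧ M.eRk X = M.eRank}.ncard) ≤ (c₁ - c₂) * 2 ^ (p + d) := by
    have h7 : {X : Set α | X ⊆ M.E ∧ M.eRk X = (7 : ℕ)}.ncard ≤ M.E.ncard.choose 7 * 2 ^ (min 72 d) := by
      have := S2.ncard_eRk_eq_le_choose_mul_two_pow M 7 (min 79 (7 + d))
        (fun X hX hr => hflat X hX (by exact_mod_cast hr))
      rwa [show min 79 (7 + d) - 7 = min 72 d by omega] at this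
    have h6 : {X : Set α | X ⊆ M.E ∧ M.eRk X = (6 : ℕ)}.ncard ≤ M.E.ncard.choose 6 * 2 ^ (39 - 6) :=
      S2.ncard_eRk_eq_le_choose_mul_two_pow M 6 39
        (fun X hX hr => ncard_le_thirtynine_of_eRk_le_six_of_free M hfree hX (by exact_mod_cast hr))
    have h5 : {X : Set α | X ⊆ M.E ∧ M.eRk X = (5 : ℕ)}.ncard ≤ M.E.ncard.choose 5 * 2 ^ (19 - 5) :=
      S2.ncard_eRk_eq_le_choose_mul_two_pow M 5 19
        (fun X hX hr => ncard_le_nineteen_of_eRk_le_five_of_free M hfree hX (by exact_mod_cast hr))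
    have h4 : {X : Set α | X ⊆ M.E ∧ M.eRk X = (4 : ℕ)}.ncard ≤ M.E.ncard.choose 4 * 2 ^ (10 - 4) :=
      S2.ncard_eRk_eq_le_choose_mul_two_pow M 4 10
        (fun X hX hr => ncard_le_ten_of_eRk_le_four_of_free M hfree hX (by exact_mod_cast hr))
    have h3 : {X : Set α | X ⊆ M.E ∧ M.eRk X = (3 : ℕ)}.ncard ≤ M.E.ncard.choose 3 * 2 ^ (6 - 3) :=
      S2.ncard_eRk_eq_le_choose_mul_two_pow M 3 6
        (fun X hX hr => ncard_le_six_of_eRk_le_three_of_free M hfree hX (by exact_mod_cast hr))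
    have h2 : {X : Set α | X ⊆ M.E ∧ M.eRk X = (2 : ℕ)}.ncard ≤ M.E.ncard.choose 2 * 2 ^ (3 - 2) :=
      S2.ncard_eRk_eq_le_choose_mul_two_pow M 2 3
        (fun X hX hr => by
          have := ncard_add_one_le_two_pow_of_eRk_le M hL0 hfree 2 X hX hr
          omega)
    have h1 : {X : Set α | X ⊆ M.E ∧ M.eRk X = (1 : ℕ)}.ncard ≤ M.E.ncard.choose 1 * 2 ^ (1 - 1) :=
      S2.ncard_eRk_eq_le_choose_mul_two_pow M 1 1
        (fun X hX hr => by
          have := ncard_add_one_le_two_pow_of_eRk_le M hL0 hfree 1 X hX hr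
          omega)
    have h0 : {X : Set α | X ⊆ M.E ∧ M.eRk X = (0 : ℕ)}.ncard ≤ M.E.ncard.choose 0 * 2 ^ (0 - 0) :=
      S2.ncard_eRk_eq_le_choose_mul_two_pow M 0 0
        (fun X hX hr => by
          have := ncard_add_one_le_two_pow_of_eRk_le M hL0 hfree 0 X hX hr
          omega)
    simp only [Nat.choose_one_right, Nat.choose_zero_right, Nat.sub_self, pow_zero, mul_one] at h1 h0
    rw [hn] at h7 h6 h5 h4 h3 h2 h1
    push_cast at hsum7 h7 h6 h5 h4 h3 h2 h1 h0
    have hA : {X : Set α | X ⊆ M.E ∧ M.eRk X ≤ 7}.ncard ≤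
        (p + d).choose 7 * 2 ^ (min 72 d) + (p + d).choose 6 * 2 ^ 33 + (p + d).choose 5 * 2 ^ 14 +
          (p + d).choose 4 * 2 ^ 6 + (p + d).choose 3 * 2 ^ 3 + (p + d).choose 2 * 2 + (p + d) + 1 := by
      omega
    have hG : {X : Set α | X ⊆ M.E ∧ M.eRk X ≤ 7}.ncard + {X : Set α | X ⊆ M.E ∧ M.eRk X = M.eRank}.ncard ≤
        (p + d).choose 7 * 2 ^ (min 72 d) + (p + d).choose 6 * 2 ^ 33 + (p + d).choose 5 * 2 ^ 14 +
          (p + d).choose 4 * 2 ^ 6 + (p + d).choose 3 * 2 ^ 3 + (p + d).choose 2 * 2 + (p + d) + 1 +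
          ∑ j ∈ Finset.range (d + 1), (p + d).choose j := by
      omega
    exact le_trans (Nat.mul_le_mul_left _ hG) hT
  -- (Φ) and the polynomial inequality
  have hΦ := phiK_le_two_pow_div p 7
  rw [Nat.choose_symm_add] at hΦ
  rw [add_assoc] at hpolyq hUq
  -- assemble in `ℚ`
  rw [RLS_iff]
  have hYq : (2 : ℚ) ^ (p + d) ≤ (Matroid.midCount M p 7 : ℚ) +
      ({X : Set α | X ⊆ M.E ∧ M.eRk X ≤ 7}.ncard : ℚ) +
      ({X : Set α | X ⊆ M.E ∧ M.eRk X = M.eRank}.ncard : ℚ) := by exact_mod_cast hY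
  have hABq : (c₁ : ℚ) * (({X : Set α | X ⊆ M.E ∧ M.eRk X ≤ 7}.ncard : ℚ) +
      ({X : Set α | X ⊆ M.E ∧ M.eRk X = M.eRank}.ncard : ℚ)) ≤
      ((c₁ - c₂ : ℕ) : ℚ) * 2 ^ (p + d) := by exact_mod_cast hAB
  have hU0' : (0 : ℚ) ≤ (Matroid.topCount M p 7 : ℚ) := Nat.cast_nonneg _
  have hd7 : 7 ≤ d := by omega
  exact level_arith_form (p := p) (d := d) (n := p + d) (q := 7) rfl hd7 hc₂ hc₁₂ hΦ hU0' hUq hYq hABq hpolyq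

end ThmN

end PercRepro
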